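import Mathlib
import HarnessLib
import Summits.HubbardSuperconductivity.HubbardSuperconductivity.Theorems.KLProgrammeKLRegimeAlphaWtRegime
import Summits.HubbardSuperconductivity.HubbardSuperconductivity.Theorems.KLProgrammeSalmhoferCutoffFourthDerivBound
import Summits.HubbardSuperconductivity.HubbardSuperconductivity.Theorems.KLProgrammeKLRegimeSymbolFrameProfileFourth
import Summits.HubbardSuperconductivity.HubbardSuperconductivity.Theorems.KLProgrammeKLRegimeEngineSliceFamBandTel
import Summits.HubbardSuperconductivity.HubbardSuperconductivity.Theorems.KLProgrammeKLRegimeEngineSliceFamThresholdsPack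
import Summits.HubbardSuperconductivity.HubbardSuperconductivity.Theorems.KLProgrammeKLRegimeEngineSliceCovAmpPack
import Summits.HubbardSuperconductivity.HubbardSuperconductivity.Theorems.KLProgrammeKLRegimeEngineSliceTelIncrementScalar
import Summits.HubbardSuperconductivity.HubbardSuperconductivity.Theorems.KLProgrammeKLRegimeEngineSliceFamRateAtoms
import Summits.HubbardSuperconductivity.HubbardSuperconductivity.Theorems.KLProgrammeKLRegimeEngineSliceTelRegimeScalars

/-!
# Route `KLProgramme` — crux K3 ENGINE (stmt-HubbardSuperconductivity-20437) stub (b) conj. 2 «(c-D)² FAMILY TELESCOPE», brick (D5t): the SIMULTANEOUS TELESCOPE IN CLOSED FORM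

Cell `gate-hubbard-kl`, seat hubbard-kl-k3c3-p2 (g11); F1-DESIGN §10.  Symbol-class level (twin of p3's `alphaWt_klSliceCov_bgmFat_of_thresholds`): along any chain of admissible
frames `K_f i` (`FrameOK R♭`, order-three data affine in `4^i` with slope `Gfr₃U²/3`) whose band increments on `[i₀, i₀+d)` are the mean-free flow pieces (jets `R`,
oscillation `c″`), with depth `4^{j+4}·16^{n_f} ≤ 4^{i₀}`, the weighted rows/columns of `S(F̃_{n_f}[K_f i])ᵀ·klSliceCov K_f i (n_f+j)·S(F̃_{n_f}[K_f i])` change by at most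
`d·𝒦·U²·(M/β)/Λ_{n_f+j}` (`𝒦 = 𝒦(j, R, c″)`).  Assembled from `famIncr_rates_uniform`, `famTel_thresholds_pack`, `rowSumWt_sliceCT_famBand_tel_le`, `covTel_amp_pack`,
`famTel_increment_scalar_le'` and the regime scalars.  Everything is proved; no definitions. [cite: BenfattoGiulianiMastropietro2006, §2.8 (2.81), §3 (3.2)–(3.8)]
-/

noncomputable section

namespace Summit.HubbardSuperconductivity.HubbardSuperconductivity.Theorems.TorusFourierL2

set_option linter.dupNamespace false -- summit = problem name (single-conjunct summit), D-0017

open Set Finset Literature.MathematicalPhysics.QuantumLattice Literature.MathematicalPhysics.QuantumLattice.BandSectorCounting Literature.Probability.LatticeModels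
open Literature.MathematicalPhysics.QuantumLattice.FermiRG Literature.Analysis.SpecialFunctions Summit.HubbardSuperconductivity.HubbardSuperconductivity.Theorems.DispersionFlow
open Summit.HubbardSuperconductivity.HubbardSuperconductivity.Theorems.KLRegimeSplit Summit.HubbardSuperconductivity.HubbardSuperconductivity.Theorems.KLProgrammeLegKernels
open Summit.HubbardSuperconductivity.HubbardSuperconductivity.Theorems.PerturbedFermiCurve Summit.HubbardSuperconductivity.HubbardSuperconductivity.Theorems.KLRegimeWick
open scoped Real Nat

set_option maxHeartbeats 8000000 in
/-- **The simultaneous family+band telescope in closed form, symbol-class level** (module docstring). [cite: BenfattoGiulianiMastropietro2006, §3 (3.2)–(3.8)] -/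
theorem famBandTel_closed (ha : (-4 : ℝ) < -(6 / 5)) (hab : (-(6 / 5) : ℝ) ≤ -(1 / 10)) (hb : (-(1 / 10) : ℝ) < 0)
    (j : ℕ) (R Rb : RenConsts) (hR : ∀ i, 0 ≤ R.Gfr i) (hRb : ∀ i, 0 ≤ Rb.Gfr i) (c'' : ℝ) (hc'' : 0 < c'') :
    ∃ 𝒦 : ℝ, 0 < 𝒦 ∧ ∀ (c U : ℝ), 0 < c →
      c ≤ min (min ((bandBounds ha hab hb).Dtmin / 4) ((bandBounds ha hab hb).rhomin / 4)) (1 / 40) / (12 * (Rb.Gfr 2 + 1)) → 0 < U →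
      U ≤ min 1 (min (min ((bandBounds ha hab hb).Dtmin / 4) ((bandBounds ha hab hb).rhomin / 4)) (1 / 40) / (24 * (Rb.Gfr 0 + Rb.Gfr 1 + 1))) →
      R.Gfr 1 * U ≤ 1 → c'' * U ≤ 1 →
      ∀ β : ℝ, klBetaMin ≤ β → β ≤ Real.exp (c / U ^ 2) → ∀ μ ∈ klWindowC,
      ∀ (L M : ℕ) [NeZero L] [NeZero M], β ^ 2 ≤ (L : ℝ) → β ≤ (M : ℝ) →
      ∀ (Kf : ℕ → TrigPolyC4v) (i₀ dn : ℕ),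
        (∀ i, i₀ ≤ i → i ≤ i₀ + dn → FrameOK Rb U (nScales β) μ (Kf i)) →
        (∀ i, i₀ ≤ i → i ≤ i₀ + dn → ∀ p : Momentum, ‖iteratedFDeriv ℝ 3 (frameShift (Kf i)) p‖ ≤ R.Gfr 3 * U ^ 2 / 3 * (4 : ℝ) ^ i) →
        (∀ i, i₀ ≤ i → i ≤ i₀ + dn → ∀ p : Momentum, ‖iteratedFDeriv ℝ 3 (frameLevel μ (Kf i)) p‖ ≤ 64 + R.Gfr 3 * U ^ 2 / 3 * (4 : ℝ) ^ i) →
        (∀ i, i₀ ≤ i → i < i₀ + dn → FlowPieceJetsAt L M β U μ R i) → (∀ i, i₀ ≤ i → i < i₀ + dn → FlowPieceOscAt L M c'' β U μ i) →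
        (∀ i, i₀ ≤ i → i < i₀ + dn → (fun q : Momentum => frameLevel μ (Kf (i + 1)) q - frameLevel μ (Kf i) q) =
          fun q => evalM (klFlowPiece L M β U μ i) q - klAngularMean (klLocalPart L M β U μ (klFlowFrameU L M β U μ i) i)) →
      ∀ nf : ℕ, 1 ≤ nf → nf + j ≤ nScales β + 1 → (4 : ℝ) ^ (j + 4) * (16 : ℝ) ^ nf ≤ (4 : ℝ) ^ i₀ → ∀ nw : ℕ, nf + j ≤ nw →
        (∀ Y : SpaceTimeIdx L M × SectorLeg (sectorCount nf),
          ∑ Y', ‖((sectorSubMatrix L M β (bgmFatMultiplier L M klE0 β (nambuXiCT L μ (Kf (i₀ + dn))) nf)).transpose * klSliceCov L M β μ (Kf (i₀ + dn)) (nf + j) *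
              sectorSubMatrix L M β (bgmFatMultiplier L M klE0 β (nambuXiCT L μ (Kf (i₀ + dn))) nf)) Y Y'‖ * EngineV8.klScaleWt L M β nw {EngineV8.latticeLegPos (2 * (2 * M)) Y, EngineV8.latticeLegPos (2 * (2 * M)) Y'} ≤
          ∑ Y', ‖((sectorSubMatrix L M β (bgmFatMultiplier L M klE0 β (nambuXiCT L μ (Kf i₀)) nf)).transpose * klSliceCov L M β μ (Kf i₀) (nf + j) *
              sectorSubMatrix L M β (bgmFatMultiplier L M klE0 β (nambuXiCT L μ (Kf i₀)) nf)) Y Y'‖ * EngineV8.klScaleWt L M β nw {EngineV8.latticeLegPos (2 * (2 * M)) Y, EngineV8.latticeLegPos (2 * (2 * M)) Y'} +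
            (dn : ℝ) * (𝒦 * U ^ 2 * ((M : ℝ) / β) / klScale klE0 (nf + j))) ∧
        (∀ Y' : SpaceTimeIdx L M × SectorLeg (sectorCount nf),
          ∑ Y, ‖((sectorSubMatrix L M β (bgmFatMultiplier L M klE0 β (nambuXiCT L μ (Kf (i₀ + dn))) nf)).transpose * klSliceCov L M β μ (Kf (i₀ + dn)) (nf + j) *
              sectorSubMatrix L M β (bgmFatMultiplier L M klE0 β (nambuXiCT L μ (Kf (i₀ + dn))) nf)) Y Y'‖ * EngineV8.klScaleWt L M β nw {EngineV8.latticeLegPos (2 * (2 * M)) Y, EngineV8.latticeLegPos (2 * (2 * M)) Y'} ≤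
          ∑ Y, ‖((sectorSubMatrix L M β (bgmFatMultiplier L M klE0 β (nambuXiCT L μ (Kf i₀)) nf)).transpose * klSliceCov L M β μ (Kf i₀) (nf + j) *
              sectorSubMatrix L M β (bgmFatMultiplier L M klE0 β (nambuXiCT L μ (Kf i₀)) nf)) Y Y'‖ * EngineV8.klScaleWt L M β nw {EngineV8.latticeLegPos (2 * (2 * M)) Y, EngineV8.latticeLegPos (2 * (2 * M)) Y'} +
            (dn : ℝ) * (𝒦 * U ^ 2 * ((M : ℝ) / β) / klScale klE0 (nf + j))) := by
  -- the window band bounds, `κ₀`, `A := κ₀/4` (as in `alphaWt_klSliceCov_bgmFat_of_thresholds`)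
  set B : BandBounds (-(6 / 5)) (-(1 / 10)) := bandBounds ha hab hb with hBdef
  set κ₀ : ℝ := min (min (B.Dtmin / 4) (B.rhomin / 4)) (1 / 40) with hκ₀
  have hDt := B.Dtmin_pos; have hrh := B.rhomin_pos
  have hκ₀pos : 0 < κ₀ := by rw [hκ₀]; exact lt_min (lt_min (by positivity) (by positivity)) (by norm_num)
  have hκ₀Dt : κ₀ ≤ B.Dtmin / 4 := (min_le_left _ _).trans (min_le_left _ _)
  have hκ₀rh : κ₀ ≤ B.rhomin / 4 := (min_le_left _ _).trans (min_le_right _ _)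
  have hκ₀40 : κ₀ ≤ 1 / 40 := min_le_right _ _
  have hrh2 : B.rhomin ≤ 2 := by
    have : B.rhomin = cRhomin (-(6 / 5)) (-(1 / 10)) := rfl
    rw [this]; exact cRhomin_le_two (by norm_num) (by norm_num)
  have he : (0 : ℝ) < klE0 := by norm_num [klE0]
  have he1 : klE0 ≤ 1 := by norm_num [klE0]
  obtain ⟨d₀, hd₀, hd₀1, hd₀2, hd₀3, hd₀4⟩ := exists_abs_derivs4_bgmCutoffSq_le he
  obtain ⟨B₀, hB₀0, hB₀⟩ := exists_norm_iteratedDeriv_sectorWeightCirc_polarAngle_line_le 2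
  obtain ⟨B₃a, hB₃a0, hB₃a⟩ := exists_norm_iteratedDeriv_sectorWeightCirc_polarAngle_line_le 3
  set A : ℝ := κ₀ / 4 with hAdef
  have hA0 : 0 < A := by rw [hAdef]; positivity
  have hDtA : 0 < B.Dtmin - 2 * A := by rw [hAdef]; linarith
  have hγ : 0 < 2 * B.rhomin - 4 * A := by rw [hAdef]; linarith
  have hγ4 : 2 * B.rhomin - 4 * A ≤ 4 := by linarith
  have hsm := B.smax_pos; have hπ := Real.pi_pos; have hπ3 := Real.pi_gt_three
  -- the fixed scale-free constants of the telescope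
  obtain ⟨cρ, hcρ⟩ : ∃ y : ℝ, y = (2 * klE0 / π + B.smax * B.Dtmin * (3 / 4)) / (B.Dtmin - 2 * A) + π * Real.sqrt 2 * (1 + (4 + 2 * A) / (B.Dtmin - 2 * A)) := ⟨_, rfl⟩
  obtain ⟨ρfM, hρfM⟩ : ∃ y : ℝ, y = (klE0 + B.smax * B.Dtmin * (3 * (π / 2) / 4)) / (B.Dtmin - 2 * A) + π * Real.sqrt 2 * (1 + (4 + 2 * A) / (B.Dtmin - 2 * A)) * (π / 2) :=
    ⟨_, rfl⟩
  have hcρ0 : 0 < cρ := by rw [hcρ]; positivity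
  have hρfM0 : 0 ≤ ρfM := by rw [hρfM]; positivity
  obtain ⟨T₀, hT₀⟩ : ∃ y : ℝ, y = (4 + 2 * A) / (2 - 1) + 7 * (Real.sqrt 2 * ρfM) := ⟨_, rfl⟩
  have hT₀0 : 0 ≤ T₀ := by rw [hT₀]; norm_num; positivity
  obtain ⟨Q, hQ0, hQ⟩ := famIncr_rates_uniform (T₀ := T₀) (A := A) (ε₂ := 4 + 4 * A) (E₀ := 4) (E₁ := 32 * (R.Gfr 3 / 3)) (e₀ := klE0) (d := d₀)
    (Ba := B₃a) (zc := 1) (g₀ := c'') (g₁ := R.Gfr 1) (g₂ := R.Gfr 2) (g₃ := R.Gfr 3) (γ₁ := R.Gfr 1 / c'') (γ₂ := R.Gfr 2 / c'') (γ₃ := R.Gfr 3 / c'')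
    hT₀0 hA0.le (by positivity) (by norm_num) (by have := hR 3; positivity) hd₀ hB₃a0 zero_le_one hc''.le (hR 1) (hR 2) (hR 3)
    (by have := hR 1; positivity) (by have := hR 2; positivity) (by have := hR 3; positivity)
  obtain ⟨bs, hbs⟩ : ∃ y : ℝ, y = T₀ + 8 := ⟨_, rfl⟩
  have hbs0 : 0 ≤ bs := by rw [hbs]; positivity
  have h7bs : (7 : ℝ) ≤ bs := by rw [hbs]; linarith
  obtain ⟨ℭ, hℭ⟩ : ∃ y : ℝ, y = (343 * (64 * (44900 : ℝ) + 480 * (448 / 3 * Real.exp 2) + 1728 * (32 / 3 : ℝ) + 1536) * bs ^ 3 +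
      21 * (32 * (448 / 3 * Real.exp 2) + 144 * (32 / 3 : ℝ) + 128) * bs * 7 + (16 * (32 / 3 : ℝ) + 16) * 64 +
        3 * Q * (36 * (32 * (448 / 3 * Real.exp 2) + 144 * (32 / 3 : ℝ) + 128) * bs ^ 2 + (16 * (32 / 3 : ℝ) + 16) * 7) + 15 * Q * (16 * (32 / 3 : ℝ) + 16) * bs + 4 * Q) +
      (21 * (32 * (448 / 3 * Real.exp 2) + 144 * (32 / 3 : ℝ) + 128) * bs * 0 + (16 * (32 / 3 : ℝ) + 16) * (4 * (R.Gfr 3 / 3)) +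
        3 * Q * (36 * (32 * (448 / 3 * Real.exp 2) + 144 * (32 / 3 : ℝ) + 128) * bs ^ 2 + (16 * (32 / 3 : ℝ) + 16) * 7) +
        3 * Q * ((16 * (32 / 3 : ℝ) + 16) * 0) + 15 * Q * (16 * (32 / 3 : ℝ) + 16) * bs + 4 * Q) +
      (3 * Q * ((16 * (32 / 3 : ℝ) + 16) * 0) + 15 * Q * (16 * (32 / 3 : ℝ) + 16) * bs + 4 * Q) + 4 * Q := ⟨_, rfl⟩
  obtain ⟨𝔴, h𝔴⟩ : ∃ y : ℝ, y = (25 * (32 * (448 / 3 * Real.exp 2) + 144 * (32 / 3 : ℝ) + 128) * bs ^ 2 + (16 * (32 / 3 : ℝ) + 16) * 7 +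
      8 * Q * (16 * (32 / 3 : ℝ) + 16) * bs + 4 * Q) + ((16 * (32 / 3 : ℝ) + 16) * 0 + 8 * Q * (16 * (32 / 3 : ℝ) + 16) * bs + 4 * Q) + 4 * Q := ⟨_, rfl⟩
  have hℭ0 : 0 ≤ ℭ := by rw [hℭ]; have := hR 3; positivity
  have h𝔴0 : 0 ≤ 𝔴 := by rw [h𝔴]; positivity
  obtain ⟨ρ, hρ⟩ : ∃ y : ℝ, y = min 1 (8 / (π ^ 3 * (ℭ + 1))) := ⟨_, rfl⟩
  obtain ⟨ρ₃, hρ₃⟩ : ∃ y : ℝ, y = min 1 (16 / (π ^ 2 * (3 * 𝔴 + 1))) := ⟨_, rfl⟩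
  have hρ0 : 0 < ρ := by rw [hρ]; exact lt_min one_pos (by positivity)
  have hρ₃0 : 0 < ρ₃ := by rw [hρ₃]; exact lt_min one_pos (by positivity)
  have hρ1 : ρ ≤ 1 := by rw [hρ]; exact min_le_left _ _
  have hρ₃1 : ρ₃ ≤ 1 := by rw [hρ₃]; exact min_le_left _ _
  have hρℭ : ℭ * ρ ^ 3 ≤ 8 / π ^ 3 := by
    have h1 : ρ ^ 3 ≤ ρ := by simpa using pow_le_pow_of_le_one hρ0.le hρ1 (by norm_num : 1 ≤ 3)
    have h2 : ρ ≤ 8 / (π ^ 3 * (ℭ + 1)) := by rw [hρ]; exact min_le_right _ _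
    have h3 : ℭ * (8 / (π ^ 3 * (ℭ + 1))) ≤ 8 / π ^ 3 := by
      rw [mul_div_assoc', div_le_div_iff₀ (by positivity) (by positivity)]; nlinarith only [hℭ0, pow_pos hπ 3]
    exact (mul_le_mul_of_nonneg_left (h1.trans h2) hℭ0).trans h3
  have hρ𝔴 : 3 * 𝔴 * ρ₃ ^ 2 ≤ 16 / π ^ 2 := by
    have h1 : ρ₃ ^ 2 ≤ ρ₃ := by simpa using pow_le_pow_of_le_one hρ₃0.le hρ₃1 (by norm_num : 1 ≤ 2)
    have h2 : ρ₃ ≤ 16 / (π ^ 2 * (3 * 𝔴 + 1)) := by rw [hρ₃]; exact min_le_right _ _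
    have h3 : 3 * 𝔴 * (16 / (π ^ 2 * (3 * 𝔴 + 1))) ≤ 16 / π ^ 2 := by
      rw [mul_div_assoc', div_le_div_iff₀ (by positivity) (by positivity)]; nlinarith only [h𝔴0, pow_pos hπ 2]
    exact (mul_le_mul_of_nonneg_left (h1.trans h2) (by positivity)).trans h3
  obtain ⟨Θt, hΘt⟩ : ∃ y : ℝ, y = (64 * (44900 : ℝ) + 480 * (448 / 3 * Real.exp 2) + 1728 * (32 / 3 : ℝ) + 1536) +
      3 * (2 * klE0 ^ 2 + 2 * (d₀ * klE0 ^ 2)) * (32 * (448 / 3 * Real.exp 2) + 144 * (32 / 3 : ℝ) + 128) +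
      3 * (4 * klE0 ^ 4 + 2 * klE0 ^ 2 + 8 * (d₀ * klE0 ^ 4) + (4 * (d₀ * klE0 ^ 4) + 2 * (d₀ * klE0 ^ 2))) * (16 * (32 / 3 : ℝ) + 16) +
      4 * (8 * klE0 ^ 6 + 12 * klE0 ^ 4 + 6 * (d₀ * klE0 ^ 2) * (4 * klE0 ^ 4 + 2 * klE0 ^ 2) + 6 * klE0 ^ 2 * (4 * (d₀ * klE0 ^ 4) + 2 * (d₀ * klE0 ^ 2)) +
        (8 * (d₀ * klE0 ^ 6) + 12 * (d₀ * klE0 ^ 4))) := ⟨_, rfl⟩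
  have hΘt0 : 0 ≤ Θt := by rw [hΘt]; positivity
  obtain ⟨σ, hσ⟩ : ∃ y : ℝ, y = min 1 (4 / (π ^ 3 * Θt + 4)) := ⟨_, rfl⟩
  have hσ0 : 0 < σ := by rw [hσ]; exact lt_min one_pos (by positivity)
  have hσ1 : σ ≤ 1 := by rw [hσ]; exact min_le_left _ _
  have hΘ : π ^ 3 * σ ^ 3 * Θt ≤ 4 := by
    have h1 : σ ^ 3 ≤ σ := by simpa using pow_le_pow_of_le_one hσ0.le hσ1 (by norm_num : 1 ≤ 3)
    have h2 : σ ≤ 4 / (π ^ 3 * Θt + 4) := by rw [hσ]; exact min_le_right _ _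
    have h3 : π ^ 3 * (4 / (π ^ 3 * Θt + 4)) * Θt ≤ 4 := by
      rw [mul_div_assoc', div_mul_eq_mul_div, div_le_iff₀ (by positivity)]; nlinarith only [hΘt0, pow_pos hπ 3]
    calc π ^ 3 * σ ^ 3 * Θt ≤ π ^ 3 * σ * Θt := by gcongr
      _ ≤ π ^ 3 * (4 / (π ^ 3 * Θt + 4)) * Θt := by gcongr
      _ ≤ 4 := h3
  obtain ⟨Dc, hDc⟩ : ∃ y : ℝ, y = 1 + 1 / ρ + 1 / (2 * σ) := ⟨_, rfl⟩
  have h21 : (0 : ℝ) < 2 - 1 := by norm_num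
  have h25 : (0 : ℝ) < 2 + 1 / 2 := by norm_num
  have hDc0 : 0 < Dc := by rw [hDc]; positivity
  have hR1 := hR 1; have hR2 := hR 2; have hR3 := hR 3
  -- the scale-free amplitude constant of `covTel_amp_pack` and the final constant
  obtain ⟨𝒜c, h𝒜c⟩ : ∃ y : ℝ, y = (
      (16 * (32 / 3) + 16) + π ^ 3 * σ ^ 3 * ((128 * 3960000 + 1216 * 44900 + 6912 * (448 / 3 * Real.exp 2) + 26112 * (32 / 3) + 24576) + 3 * (2 * (d₀ * klE0 ^ 2 * 1 + 1 * (d₀ * klE0 ^ 2))) * (64 * 44900 + 416 * (448 / 3 * Real.exp 2) + 1600 * (32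
      / 3) + 1536) + 3 * (4 * (d₀ * klE0 ^ 4 * 1 + 2 * (d₀ * klE0 ^ 2) * (d₀ * klE0 ^ 2) + 1 * (d₀ * klE0 ^ 4)) + 2 * (d₀ * klE0 ^ 2 * 1 + 1 * (d₀ * klE0 ^ 2))) * (32 * (448 / 3 * Real.exp 2) + 128 * (32 / 3) + 128) + (8 * (d₀ * klE0 ^ 6 * 1 + 3 *
      (d₀ * klE0 ^ 4) * (d₀ * klE0 ^ 2) + 3 * (d₀ * klE0 ^ 2) * (d₀ * klE0 ^ 4) + 1 * (d₀ * klE0 ^ 6)) + 12 * (d₀ * klE0 ^ 4 * 1 + 2 * (d₀ * klE0 ^ 2) * (d₀ * klE0 ^ 2) + 1 * (d₀ * klE0 ^ 4))) * (16 * (32 / 3) + 16)) + ρ ^ 3 / 64 * ( ((Real.sqrt 2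
      * (2 * π)) ^ 3 * ((128 * 3960000 + 1408 * 44900 + 7776 * (448 / 3 * Real.exp 2) + 27648 * (32 / 3) + 24576) * (7 + (R.Gfr 1 / c'') * c'') ^ 3 + (64 * 44900 + 480 * (448 / 3 * Real.exp 2) + 1728 * (32 / 3) + 1536) * (R.Gfr 1 / c'') * (3 * 7 ^
      2 + 3 * 7 * ((R.Gfr 1 / c'') * c'') + ((R.Gfr 1 / c'') * c'') ^ 2) + 3 * ((64 * 44900 + 480 * (448 / 3 * Real.exp 2) + 1728 * (32 / 3) + 1536) * ((7 + (R.Gfr 1 / c'') * c'') * (7 + (R.Gfr 2 / c'') * c'')) + (32 * (448 / 3 * Real.exp 2) + 144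
      * (32 / 3) + 128) * (7 * (R.Gfr 2 / c'') + (R.Gfr 1 / c'') * 7 + (R.Gfr 1 / c'') * (R.Gfr 2 / c'') * c'')) + ((32 * (448 / 3 * Real.exp 2) + 144 * (32 / 3) + 128) * ((64 + R.Gfr 3 / 3) + (R.Gfr 3 / c'') * c'') + (16 * (32 / 3) + 16) * (R.Gfr
      3 / c''))) + 3 * ((2 * (d₀ * klE0 ^ 2 * 1 + 1 * (d₀ * klE0 ^ 2)) * ((4 + 2 * A) * (2 * π) + (4 + 4 * A) * (ρfM + 4 * π) * (2 * π)) + 9 * (4 * B₀ * ((1 + 2 * (2 * klE0 / π)) * (2 * (2 * π)))))) * (2 * (2 * π) ^ 2) * ((64 * 44900 + 480 * (448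
      / 3 * Real.exp 2) + 1728 * (32 / 3) + 1536) * (7 + (R.Gfr 1 / c'') * c'') ^ 2 + (32 * (448 / 3 * Real.exp 2) + 144 * (32 / 3) + 128) * (R.Gfr 1 / c'') * (2 * 7 + (R.Gfr 1 / c'') * c'') + (32 * (448 / 3 * Real.exp 2) + 144 * (32 / 3) + 128) *
      (7 + (R.Gfr 2 / c'') * c'') + (16 * (32 / 3) + 16) * (R.Gfr 2 / c'')) + 3 * (((4 * (d₀ * klE0 ^ 4 * 1 + 2 * (d₀ * klE0 ^ 2) * (d₀ * klE0 ^ 2) + 1 * (d₀ * klE0 ^ 4)) + 2 * (d₀ * klE0 ^ 2 * 1 + 1 * (d₀ * klE0 ^ 2))) * ((4 + 2 * A) * (2 * π) +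
      (4 + 4 * A) * (ρfM + 4 * π) * (2 * π)) ^ 2 + 2 * (d₀ * klE0 ^ 2 * 1 + 1 * (d₀ * klE0 ^ 2)) * ((4 + 4 * A) * (2 * π) ^ 2) + 4 * (d₀ * klE0 ^ 2 * 1 + 1 * (d₀ * klE0 ^ 2)) * ((4 + 2 * A) * (2 * π) + (4 + 4 * A) * (ρfM + 4 * π) * (2 * π)) * (9 *
      (4 * B₀ * ((1 + 2 * (2 * klE0 / π)) * (2 * (2 * π))))) + 9 * (4 * B₀ * ((1 + 2 * (2 * klE0 / π)) * (2 * (2 * π))) ^ 2 + 8 * B₀ ^ 2 * ((1 + 2 * (2 * klE0 / π)) * (2 * (2 * π))) ^ 2))) * (Real.sqrt 2 * (2 * π)) * ((32 * (448 / 3 * Real.exp 2)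
      + 144 * (32 / 3) + 128) * (7 + (R.Gfr 1 / c'') * c'') + (16 * (32 / 3) + 16) * (R.Gfr 1 / c'')) + (((8 * (d₀ * klE0 ^ 6 * 1 + 3 * (d₀ * klE0 ^ 4) * (d₀ * klE0 ^ 2) + 3 * (d₀ * klE0 ^ 2) * (d₀ * klE0 ^ 4) + 1 * (d₀ * klE0 ^ 6)) + 12 * (d₀ *
      klE0 ^ 4 * 1 + 2 * (d₀ * klE0 ^ 2) * (d₀ * klE0 ^ 2) + 1 * (d₀ * klE0 ^ 4))) * (4 + 2 * A) ^ 3 + (12 * (d₀ * klE0 ^ 4 * 1 + 2 * (d₀ * klE0 ^ 2) * (d₀ * klE0 ^ 2) + 1 * (d₀ * klE0 ^ 4)) + 6 * (d₀ * klE0 ^ 2 * 1 + 1 * (d₀ * klE0 ^ 2))) * (4 +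
      2 * A) * (4 + 4 * A) * klE0 + 2 * (d₀ * klE0 ^ 2 * 1 + 1 * (d₀ * klE0 ^ 2)) * (4 * klE0 ^ 2) + 216 * 9 * B₃a * ((4 * (d₀ * klE0 ^ 4 * 1 + 2 * (d₀ * klE0 ^ 2) * (d₀ * klE0 ^ 2) + 1 * (d₀ * klE0 ^ 4)) + 2 * (d₀ * klE0 ^ 2 * 1 + 1 * (d₀ * klE0
      ^ 2))) * (4 + 2 * A) ^ 2 * (2 * klE0) + 2 * (d₀ * klE0 ^ 2 * 1 + 1 * (d₀ * klE0 ^ 2)) * (4 + 4 * A) * klE0 * (2 * klE0)) + 216 * 9 * (d₀ * klE0 ^ 2 * 1 + 1 * (d₀ * klE0 ^ 2)) * (4 + 2 * A) * (12 * B₃a + 72 * B₃a ^ 2) * (2 * klE0) ^ 2 + 216 *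
      9 * (12 * B₃a + 216 * B₃a ^ 2) * (2 * klE0) ^ 3) + 16 * (d₀ * klE0 ^ 2 * 1 + 1 * (d₀ * klE0 ^ 2)) * (R.Gfr 3 / 3)) * (2 * π) ^ 3 * (16 * (32 / 3) + 16)) + ((Real.sqrt 2 * (5 * π)) ^ 3 * ((128 * 3960000 + 1408 * 44900 + 7776 * (448 / 3 *
      Real.exp 2) + 27648 * (32 / 3) + 24576) * (7 + (R.Gfr 1 / c'') * c'') ^ 3 + (64 * 44900 + 480 * (448 / 3 * Real.exp 2) + 1728 * (32 / 3) + 1536) * (R.Gfr 1 / c'') * (3 * 7 ^ 2 + 3 * 7 * ((R.Gfr 1 / c'') * c'') + ((R.Gfr 1 / c'') * c'') ^ 2)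
      + 3 * ((64 * 44900 + 480 * (448 / 3 * Real.exp 2) + 1728 * (32 / 3) + 1536) * ((7 + (R.Gfr 1 / c'') * c'') * (7 + (R.Gfr 2 / c'') * c'')) + (32 * (448 / 3 * Real.exp 2) + 144 * (32 / 3) + 128) * (7 * (R.Gfr 2 / c'') + (R.Gfr 1 / c'') * 7 +
      (R.Gfr 1 / c'') * (R.Gfr 2 / c'') * c'')) + ((32 * (448 / 3 * Real.exp 2) + 144 * (32 / 3) + 128) * ((64 + R.Gfr 3 / 3) + (R.Gfr 3 / c'') * c'') + (16 * (32 / 3) + 16) * (R.Gfr 3 / c''))) + 3 * ((2 * (d₀ * klE0 ^ 2 * 1 + 1 * (d₀ * klE0 ^ 2))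
      * ((4 + 2 * A) * (5 * π) + (4 + 4 * A) * (ρfM + 10 * π) * (5 * π)) + 9 * (4 * B₀ * ((1 + 2 * (2 * klE0 / π)) * (2 * (5 * π)))))) * (2 * (5 * π) ^ 2) * ((64 * 44900 + 480 * (448 / 3 * Real.exp 2) + 1728 * (32 / 3) + 1536) * (7 + (R.Gfr 1 /
      c'') * c'') ^ 2 + (32 * (448 / 3 * Real.exp 2) + 144 * (32 / 3) + 128) * (R.Gfr 1 / c'') * (2 * 7 + (R.Gfr 1 / c'') * c'') + (32 * (448 / 3 * Real.exp 2) + 144 * (32 / 3) + 128) * (7 + (R.Gfr 2 / c'') * c'') + (16 * (32 / 3) + 16) * (R.Gfr 2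
      / c'')) + 3 * (((4 * (d₀ * klE0 ^ 4 * 1 + 2 * (d₀ * klE0 ^ 2) * (d₀ * klE0 ^ 2) + 1 * (d₀ * klE0 ^ 4)) + 2 * (d₀ * klE0 ^ 2 * 1 + 1 * (d₀ * klE0 ^ 2))) * ((4 + 2 * A) * (5 * π) + (4 + 4 * A) * (ρfM + 10 * π) * (5 * π)) ^ 2 + 2 * (d₀ * klE0 ^
      2 * 1 + 1 * (d₀ * klE0 ^ 2)) * ((4 + 4 * A) * (5 * π) ^ 2) + 4 * (d₀ * klE0 ^ 2 * 1 + 1 * (d₀ * klE0 ^ 2)) * ((4 + 2 * A) * (5 * π) + (4 + 4 * A) * (ρfM + 10 * π) * (5 * π)) * (9 * (4 * B₀ * ((1 + 2 * (2 * klE0 / π)) * (2 * (5 * π))))) + 9 *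
      (4 * B₀ * ((1 + 2 * (2 * klE0 / π)) * (2 * (5 * π))) ^ 2 + 8 * B₀ ^ 2 * ((1 + 2 * (2 * klE0 / π)) * (2 * (5 * π))) ^ 2))) * (Real.sqrt 2 * (5 * π)) * ((32 * (448 / 3 * Real.exp 2) + 144 * (32 / 3) + 128) * (7 + (R.Gfr 1 / c'') * c'') + (16 *
      (32 / 3) + 16) * (R.Gfr 1 / c'')) + (((8 * (d₀ * klE0 ^ 6 * 1 + 3 * (d₀ * klE0 ^ 4) * (d₀ * klE0 ^ 2) + 3 * (d₀ * klE0 ^ 2) * (d₀ * klE0 ^ 4) + 1 * (d₀ * klE0 ^ 6)) + 12 * (d₀ * klE0 ^ 4 * 1 + 2 * (d₀ * klE0 ^ 2) * (d₀ * klE0 ^ 2) + 1 * (d₀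
      * klE0 ^ 4))) * (4 + 2 * A) ^ 3 + (12 * (d₀ * klE0 ^ 4 * 1 + 2 * (d₀ * klE0 ^ 2) * (d₀ * klE0 ^ 2) + 1 * (d₀ * klE0 ^ 4)) + 6 * (d₀ * klE0 ^ 2 * 1 + 1 * (d₀ * klE0 ^ 2))) * (4 + 2 * A) * (4 + 4 * A) * klE0 + 2 * (d₀ * klE0 ^ 2 * 1 + 1 * (d₀
      * klE0 ^ 2)) * (4 * klE0 ^ 2) + 216 * 9 * B₃a * ((4 * (d₀ * klE0 ^ 4 * 1 + 2 * (d₀ * klE0 ^ 2) * (d₀ * klE0 ^ 2) + 1 * (d₀ * klE0 ^ 4)) + 2 * (d₀ * klE0 ^ 2 * 1 + 1 * (d₀ * klE0 ^ 2))) * (4 + 2 * A) ^ 2 * (2 * klE0) + 2 * (d₀ * klE0 ^ 2 * 1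
      + 1 * (d₀ * klE0 ^ 2)) * (4 + 4 * A) * klE0 * (2 * klE0)) + 216 * 9 * (d₀ * klE0 ^ 2 * 1 + 1 * (d₀ * klE0 ^ 2)) * (4 + 2 * A) * (12 * B₃a + 72 * B₃a ^ 2) * (2 * klE0) ^ 2 + 216 * 9 * (12 * B₃a + 216 * B₃a ^ 2) * (2 * klE0) ^ 3) + 16 * (d₀ *
      klE0 ^ 2 * 1 + 1 * (d₀ * klE0 ^ 2)) * (R.Gfr 3 / 3)) * (5 * π) ^ 3 * (16 * (32 / 3) + 16)) + ((Real.sqrt 2 * (5 * π)) ^ 3 * ((128 * 3960000 + 1408 * 44900 + 7776 * (448 / 3 * Real.exp 2) + 27648 * (32 / 3) + 24576) * (7 + (R.Gfr 1 / c'') *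
      c'') ^ 3 + (64 * 44900 + 480 * (448 / 3 * Real.exp 2) + 1728 * (32 / 3) + 1536) * (R.Gfr 1 / c'') * (3 * 7 ^ 2 + 3 * 7 * ((R.Gfr 1 / c'') * c'') + ((R.Gfr 1 / c'') * c'') ^ 2) + 3 * ((64 * 44900 + 480 * (448 / 3 * Real.exp 2) + 1728 * (32 /
      3) + 1536) * ((7 + (R.Gfr 1 / c'') * c'') * (7 + (R.Gfr 2 / c'') * c'')) + (32 * (448 / 3 * Real.exp 2) + 144 * (32 / 3) + 128) * (7 * (R.Gfr 2 / c'') + (R.Gfr 1 / c'') * 7 + (R.Gfr 1 / c'') * (R.Gfr 2 / c'') * c'')) + ((32 * (448 / 3 *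
      Real.exp 2) + 144 * (32 / 3) + 128) * ((64 + R.Gfr 3 / 3) + (R.Gfr 3 / c'') * c'') + (16 * (32 / 3) + 16) * (R.Gfr 3 / c''))) + 3 * ((2 * (d₀ * klE0 ^ 2 * 1 + 1 * (d₀ * klE0 ^ 2)) * ((2 * π) * (4 + 2 * A) + (4 + 4 * A) * (ρfM + 10 * π) * (5
      * π)) + 9 * (4 * B₀ * ((1 + 2 * (2 * klE0 / π)) * (2 * (5 * π)))))) * (2 * (5 * π) ^ 2) * ((64 * 44900 + 480 * (448 / 3 * Real.exp 2) + 1728 * (32 / 3) + 1536) * (7 + (R.Gfr 1 / c'') * c'') ^ 2 + (32 * (448 / 3 * Real.exp 2) + 144 * (32 / 3)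
      + 128) * (R.Gfr 1 / c'') * (2 * 7 + (R.Gfr 1 / c'') * c'') + (32 * (448 / 3 * Real.exp 2) + 144 * (32 / 3) + 128) * (7 + (R.Gfr 2 / c'') * c'') + (16 * (32 / 3) + 16) * (R.Gfr 2 / c'')) + 3 * (((4 * (d₀ * klE0 ^ 4 * 1 + 2 * (d₀ * klE0 ^ 2) *
      (d₀ * klE0 ^ 2) + 1 * (d₀ * klE0 ^ 4)) + 2 * (d₀ * klE0 ^ 2 * 1 + 1 * (d₀ * klE0 ^ 2))) * ((2 * π) * (4 + 2 * A) + (4 + 4 * A) * (ρfM + 10 * π) * (5 * π)) ^ 2 + 2 * (d₀ * klE0 ^ 2 * 1 + 1 * (d₀ * klE0 ^ 2)) * ((4 + 4 * A) * (5 * π) ^ 2) + 4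
      * (d₀ * klE0 ^ 2 * 1 + 1 * (d₀ * klE0 ^ 2)) * ((2 * π) * (4 + 2 * A) + (4 + 4 * A) * (ρfM + 10 * π) * (5 * π)) * (9 * (4 * B₀ * ((1 + 2 * (2 * klE0 / π)) * (2 * (5 * π))))) + 9 * (4 * B₀ * ((1 + 2 * (2 * klE0 / π)) * (2 * (5 * π))) ^ 2 + 8 *
      B₀ ^ 2 * ((1 + 2 * (2 * klE0 / π)) * (2 * (5 * π))) ^ 2))) * (Real.sqrt 2 * (5 * π)) * ((32 * (448 / 3 * Real.exp 2) + 144 * (32 / 3) + 128) * (7 + (R.Gfr 1 / c'') * c'') + (16 * (32 / 3) + 16) * (R.Gfr 1 / c'')) + (((8 * (d₀ * klE0 ^ 6 * 1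
      + 3 * (d₀ * klE0 ^ 4) * (d₀ * klE0 ^ 2) + 3 * (d₀ * klE0 ^ 2) * (d₀ * klE0 ^ 4) + 1 * (d₀ * klE0 ^ 6)) + 12 * (d₀ * klE0 ^ 4 * 1 + 2 * (d₀ * klE0 ^ 2) * (d₀ * klE0 ^ 2) + 1 * (d₀ * klE0 ^ 4))) * (4 + 2 * A) ^ 3 + (12 * (d₀ * klE0 ^ 4 * 1 + 2
      * (d₀ * klE0 ^ 2) * (d₀ * klE0 ^ 2) + 1 * (d₀ * klE0 ^ 4)) + 6 * (d₀ * klE0 ^ 2 * 1 + 1 * (d₀ * klE0 ^ 2))) * (4 + 2 * A) * (4 + 4 * A) * klE0 + 2 * (d₀ * klE0 ^ 2 * 1 + 1 * (d₀ * klE0 ^ 2)) * (4 * klE0 ^ 2) + 216 * 9 * B₃a * ((4 * (d₀ *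
      klE0 ^ 4 * 1 + 2 * (d₀ * klE0 ^ 2) * (d₀ * klE0 ^ 2) + 1 * (d₀ * klE0 ^ 4)) + 2 * (d₀ * klE0 ^ 2 * 1 + 1 * (d₀ * klE0 ^ 2))) * (4 + 2 * A) ^ 2 * (2 * klE0) + 2 * (d₀ * klE0 ^ 2 * 1 + 1 * (d₀ * klE0 ^ 2)) * (4 + 4 * A) * klE0 * (2 * klE0)) +
      216 * 9 * (d₀ * klE0 ^ 2 * 1 + 1 * (d₀ * klE0 ^ 2)) * (4 + 2 * A) * (12 * B₃a + 72 * B₃a ^ 2) * (2 * klE0) ^ 2 + 216 * 9 * (12 * B₃a + 216 * B₃a ^ 2) * (2 * klE0) ^ 3) + 16 * (d₀ * klE0 ^ 2 * 1 + 1 * (d₀ * klE0 ^ 2)) * (R.Gfr 3 / 3)) * (5 *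
      π) ^ 3 * (16 * (32 / 3) + 16))) + ρ₃ ^ 2 / 16 * (2 * (5 * π) ^ 2 * ((64 * 44900 + 480 * (448 / 3 * Real.exp 2) + 1728 * (32 / 3) + 1536) * (7 + (R.Gfr 1 / c'') * c'') ^ 2 + (32 * (448 / 3 * Real.exp 2) + 144 * (32 / 3) + 128) * (R.Gfr 1 /
      c'') * (2 * 7 + (R.Gfr 1 / c'') * c'') + (32 * (448 / 3 * Real.exp 2) + 144 * (32 / 3) + 128) * (7 + (R.Gfr 2 / c'') * c'') + (16 * (32 / 3) + 16) * (R.Gfr 2 / c'')) + 2 * ((2 * (d₀ * klE0 ^ 2 * 1 + 1 * (d₀ * klE0 ^ 2)) * ((2 * π) * (4 + 2 *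
      A) + (4 + 4 * A) * (ρfM + 10 * π) * (5 * π)) + 9 * (4 * B₀ * ((1 + 2 * (2 * klE0 / π)) * (2 * (5 * π)))))) * (Real.sqrt 2 * (5 * π)) * ((32 * (448 / 3 * Real.exp 2) + 144 * (32 / 3) + 128) * (7 + (R.Gfr 1 / c'') * c'') + (16 * (32 / 3) + 16)
      * (R.Gfr 1 / c'')) + (((4 * (d₀ * klE0 ^ 4 * 1 + 2 * (d₀ * klE0 ^ 2) * (d₀ * klE0 ^ 2) + 1 * (d₀ * klE0 ^ 4)) + 2 * (d₀ * klE0 ^ 2 * 1 + 1 * (d₀ * klE0 ^ 2))) * ((2 * π) * (4 + 2 * A) + (4 + 4 * A) * (ρfM + 10 * π) * (5 * π)) ^ 2 + 2 * (d₀ *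
      klE0 ^ 2 * 1 + 1 * (d₀ * klE0 ^ 2)) * ((4 + 4 * A) * (5 * π) ^ 2) + 4 * (d₀ * klE0 ^ 2 * 1 + 1 * (d₀ * klE0 ^ 2)) * ((2 * π) * (4 + 2 * A) + (4 + 4 * A) * (ρfM + 10 * π) * (5 * π)) * (9 * (4 * B₀ * ((1 + 2 * (2 * klE0 / π)) * (2 * (5 *
      π))))) + 9 * (4 * B₀ * ((1 + 2 * (2 * klE0 / π)) * (2 * (5 * π))) ^ 2 + 8 * B₀ ^ 2 * ((1 + 2 * (2 * klE0 / π)) * (2 * (5 * π))) ^ 2))) * (16 * (32 / 3) + 16))) := ⟨_, rfl⟩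
  have h𝒜c0 : 0 < 𝒜c := by rw [h𝒜c]; positivity
  obtain ⟨𝒦, h𝒦⟩ : ∃ y : ℝ, y = Real.sqrt (48 * (1048576 * ((1 + 4 * Real.sqrt 2) ^ 2 * ((2 * Real.sqrt 2 / ρ + 2) * (2 * Real.sqrt 2 / ρ₃ + 2)) + (1 / ρ + 1) ^ 2) / σ) *
      (128 * (4 + (4 + 4 * A) * cρ ^ 2 * π ^ 2 / klE0) * cρ / (π ^ 2 * (2 * B.rhomin - 4 * A)) * (16 : ℝ) ^ j)) * c'' * Dc *
      (288 * (20 * (d₀ * klE0 ^ 2)) / (4 : ℝ) ^ (j + 1) + 72 * 𝒜c) := ⟨_, rfl⟩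
  have hS0 : 0 < Real.sqrt (48 * (1048576 * ((1 + 4 * Real.sqrt 2) ^ 2 * ((2 * Real.sqrt 2 / ρ + 2) * (2 * Real.sqrt 2 / ρ₃ + 2)) + (1 / ρ + 1) ^ 2) / σ) *
      (128 * (4 + (4 + 4 * A) * cρ ^ 2 * π ^ 2 / klE0) * cρ / (π ^ 2 * (2 * B.rhomin - 4 * A)) * (16 : ℝ) ^ j)) := Real.sqrt_pos.2 (by positivity)
  refine ⟨𝒦, by rw [h𝒦]; positivity, ?_⟩
  intro c U hc hcle hU hUle hG1U hcU β hβmin hβc μ hμ L M _ _ hLβ hMβ Kf i₀ dn hfr h3s h3l hJ hO hinc nf hnf hnfN hwin nw hnw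
  have hβ0 : 0 < β := pos_of_klBetaMin_le hβmin
  have hβ128 : 128 ≤ β := by simpa [klBetaMin] using hβmin
  have hL0 : (0 : ℝ) < L := lt_of_lt_of_le (by positivity) hLβ
  have hL1r : (1 : ℝ) ≤ L := le_trans (one_le_pow₀ (by linarith only [hβ128] : (1 : ℝ) ≤ β)) hLβ
  have hM0 : (0 : ℝ) < M := lt_of_lt_of_le hβ0 hMβ
  have hU1 : U ≤ 1 := hUle.trans (min_le_left _ _)
  have hU2 : U ^ 2 ≤ 1 := pow_le_one₀ hU.le hU1
  -- the frames' `C²` size is `≤ A = κ₀/4`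
  have hlog : 1 ≤ Real.log 4 := by
    have h4 : Real.exp 1 ≤ 4 := by have := Real.exp_one_lt_d9; norm_num at this; linarith
    calc (1 : ℝ) = Real.log (Real.exp 1) := (Real.log_exp 1).symm
      _ ≤ Real.log 4 := Real.log_le_log (Real.exp_pos 1) h4
  have hAK : ∀ i, i₀ ≤ i → i ≤ i₀ + dn → ∀ p : Momentum, ∀ k ≤ 2, ‖iteratedFDeriv ℝ k (frameShift (Kf i)) p‖ ≤ A := by
    intro i hi1 hi2 p k hk
    refine (norm_iteratedFDeriv_frameShift_le_of_frameOK_regime hRb hc.le hβmin hβc (hfr i hi1 hi2) p hk).trans ?_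
    have h0 := hRb 0; have h1 := hRb 1; have h2 := hRb 2
    have hUk : U ≤ κ₀ / (24 * (Rb.Gfr 0 + Rb.Gfr 1 + 1)) := hUle.trans (min_le_right _ _)
    rw [abs_of_pos hU]
    have hU2' : U ^ 2 ≤ U := by nlinarith only [hU, hU1]
    have hA1 : 2 * Rb.Gfr 0 * U + 2 * Rb.Gfr 1 * U ^ 2 ≤ 2 * (Rb.Gfr 0 + Rb.Gfr 1 + 1) * U := by
      have := mul_le_mul_of_nonneg_left hU2' h1
      linarith only [this, hU.le]
    have hB1 : 2 * (Rb.Gfr 0 + Rb.Gfr 1 + 1) * U ≤ κ₀ / 12 := by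
      have hpos : 0 < 24 * (Rb.Gfr 0 + Rb.Gfr 1 + 1) := by positivity
      have := (le_div_iff₀ hpos).mp hUk
      linarith only [this]
    have hC1 : Rb.Gfr 2 * (c / Real.log 4) ≤ Rb.Gfr 2 * c := mul_le_mul_of_nonneg_left (div_le_self hc.le hlog) h2
    have hD1 : Rb.Gfr 2 * c ≤ κ₀ / 12 := by
      have hpos : 0 < 12 * (Rb.Gfr 2 + 1) := by positivity
      have := (le_div_iff₀ hpos).mp hcle
      linarith only [this, hc.le]
    rw [hAdef]; linarith only [hA1, hB1, hC1, hD1, hκ₀pos]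
  have hμ' := hμ
  simp only [klWindowC, Set.mem_Icc] at hμ'
  have hμlo : -(21 / 20 : ℝ) ≤ μ := by rw [← show (-1.05 : ℝ) = -(21 / 20) by norm_num]; exact hμ'.1
  have hμhi : μ ≤ -(3 / 20 : ℝ) := by rw [← show (-0.15 : ℝ) = -(3 / 20) by norm_num]; exact hμ'.2
  have he0 : klE0 = 1 / 32 := rfl
  have hgap : klE0 + A + (1 / 10 : ℝ) ^ 2 < -μ := by rw [he0, hAdef]; linarith only [hμhi, hκ₀40]
  have h3 : klE0 + A - μ ≤ 3 := by rw [he0, hAdef]; linarith only [hμlo, hκ₀40]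
  have hlo : (-(6 / 5) : ℝ) ≤ μ - A - klE0 := by rw [he0, hAdef]; linarith only [hμlo, hκ₀40]
  have hhi : μ + A + klE0 ≤ -(1 / 10) := by rw [he0, hAdef]; linarith only [hμhi, hκ₀40]
  have hADt : 2 * A < B.Dtmin := by rw [hAdef]; linarith
  have hρA : 4 * A < 2 * B.rhomin := by rw [hAdef]; linarith
  have hK₁ : ∀ i, i₀ ≤ i → i ≤ i₀ + dn → ∀ p, ‖fderiv ℝ (frameLevel μ (Kf i)) p‖ ≤ 7 := fun i h1 h2 p => norm_fderiv_frameLevel_le_of_frameOK (hfr i h1 h2) p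
  have hK₂ : ∀ i, i₀ ≤ i → i ≤ i₀ + dn → ∀ p, ‖iteratedFDeriv ℝ 2 (frameLevel μ (Kf i)) p‖ ≤ 7 :=
    fun i h1 h2 p => norm_iteratedFDeriv_two_frameLevel_le_of_frameOK (hfr i h1 h2) p
  have hB₁ : ∀ x, |deriv salmhoferCutoff x| ≤ 32 / 3 := klcd_abs_deriv_salmhoferCutoff_le_sharp
  have hB₂ : ∀ x, |deriv (deriv salmhoferCutoff) x| ≤ 448 / 3 * Real.exp 2 := klsd_abs_deriv2_salmhoferCutoff_le
  have hB₃ : ∀ x, |deriv (deriv (deriv salmhoferCutoff)) x| ≤ 44900 := fun x => (kltd_abs_deriv3_salmhoferCutoff_lt x).le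
  have hB₄ : ∀ x, |deriv (deriv (deriv (deriv salmhoferCutoff))) x| ≤ 3960000 := fun x => (kltd_abs_deriv4_salmhoferCutoff_lt x).le
  -- the indices: `nf = m + 1`, slice `(Λ_{m+1+j}, Λ_{m+j}]`; the regime scalars
  obtain ⟨m, rfl⟩ : ∃ m, nf = m + 1 := ⟨nf - 1, by omega⟩
  have hswpos := sectorWidth_pos (m + 1)
  have hanti : ∀ {a b : ℕ}, a ≤ b → klScale klE0 b ≤ klScale klE0 a := fun hab' => by
    unfold klScale; exact mul_le_mul_of_nonneg_left (inv_anti₀ (by positivity) (pow_le_pow_right₀ (by norm_num) hab')) he.le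
  have hslice : ∀ K : TrigPolyC4v, klSliceCov L M β μ K (m + 1 + j) = hubbardCovSliceCT L M β μ 0 K (klScale klE0 (m + 1 + j)) (klScale klE0 (m + j)) := by
    intro K; rw [klSliceCov, show m + 1 + j - 1 = m + j by omega]
  obtain ⟨hMm, hM', hπβ, hLN, hL1, hLz2, hL40, hN2⟩ := telRegime_lattice hβmin hLβ hMβ (show m + 1 + j ≤ nScales β + 1 by omega) hγ4
  obtain ⟨hlamΛ, hΛ₁, hNΛ, hx₀W, hY1, hY, hYW, hΛW, hΛx, hlx2, hlx, hlam1, hΛlam⟩ := telRegime_refscale (m := m) (j := j) (i₀ := i₀) hwin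
  obtain ⟨hwsi, hζ, hw, hsw⟩ := telRegime_angular m
  have hΛs : 0 < klScale klE0 (m + 1 + j) := klth_klScale_pos _
  have hlam0 : 0 < klScale klE0 m := klth_klScale_pos _
  have hΛe : ∀ k, klScale klE0 k ≤ klE0 := fun k => klScale_le_e0 he.le k
  have hΛs1 : klScale klE0 (m + 1 + j) ≤ 1 := hΛlam.trans hlam1
  have hΛΛ' : klScale klE0 (m + 1 + j) ≤ klScale klE0 (m + j) := hanti (by omega)
  have hx₀1 : (1 : ℝ) ≤ (4 : ℝ) ^ i₀ := one_le_pow₀ (by norm_num)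
  have hx₀0 : (0 : ℝ) < (4 : ℝ) ^ i₀ := by positivity
  -- the increment constants `G₀ = c″U²`, `G_k = Gfr_k U²`
  have euP0 : c'' * |U| * uPow 0 U = c'' * U ^ 2 := by rw [uPow_zero, abs_of_pos hU]; ring
  have euP : ∀ k, uPow (k + 1) U = U ^ 2 := fun k => uPow_succ k U
  have hG₀pos : 0 < c'' * |U| * uPow 0 U := by rw [euP0]; positivity
  have hG₀g : c'' * |U| * uPow 0 U ≤ c'' := by rw [euP0]; exact mul_le_of_le_one_right hc''.le hU2
  have hG₁γ : R.Gfr 1 * uPow 1 U = R.Gfr 1 / c'' * (c'' * |U| * uPow 0 U) := by rw [euP0, show (1 : ℕ) = 0 + 1 from rfl, euP]; field_simp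
  have hG₂γ : R.Gfr 2 * uPow 2 U = R.Gfr 2 / c'' * (c'' * |U| * uPow 0 U) := by rw [euP0, show (2 : ℕ) = 1 + 1 from rfl, euP]; field_simp
  have hG₃γ : R.Gfr 3 * uPow 3 U = R.Gfr 3 / c'' * (c'' * |U| * uPow 0 U) := by rw [euP0, show (3 : ℕ) = 2 + 1 from rfl, euP]; field_simp
  have hG₁g : R.Gfr 1 * uPow 1 U ≤ R.Gfr 1 := by rw [show (1 : ℕ) = 0 + 1 from rfl, euP]; exact mul_le_of_le_one_right (hR 1) hU2
  have hG₂g : R.Gfr 2 * uPow 2 U ≤ R.Gfr 2 := by rw [show (2 : ℕ) = 1 + 1 from rfl, euP]; exact mul_le_of_le_one_right (hR 2) hU2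
  have hG₃g : R.Gfr 3 * uPow 3 U ≤ R.Gfr 3 := by rw [show (3 : ℕ) = 2 + 1 from rfl, euP]; exact mul_le_of_le_one_right (hR 3) hU2
  have hA31 : 0 ≤ R.Gfr 3 * U ^ 2 / 3 := by positivity
  have hGU3 : R.Gfr 3 * U ^ 2 / 3 ≤ R.Gfr 3 / 3 := div_le_div_of_nonneg_right (mul_le_of_le_one_right (hR 3) hU2) (by norm_num)
  have hE₁ : 32 * (R.Gfr 3 * U ^ 2 / 3) ≤ 32 * (R.Gfr 3 / 3) := by linarith only [hGU3]
  have hK3s : 64 + R.Gfr 3 * U ^ 2 / 3 ≤ 64 + R.Gfr 3 / 3 := by linarith only [hGU3]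
  have hb3' : 4 * (R.Gfr 3 * U ^ 2 / 3) ≤ 4 * (R.Gfr 3 / 3) := by linarith only [hGU3]
  have ha₃s : (0 + R.Gfr 3 * U ^ 2 / 3) * klScale klE0 m ^ 2 ≤ R.Gfr 3 / 3 * klScale klE0 m ^ 2 := by
    rw [zero_add]; exact mul_le_mul_of_nonneg_right hGU3 (sq_nonneg _)
  have hGΛ : c'' * |U| * uPow 0 U / ((4 : ℝ) ^ i₀) ^ 2 ≤ klScale klE0 m := by
    rw [euP0, div_le_iff₀ (by positivity)]
    have h1 : c'' * U ^ 2 ≤ 1 := by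
      calc c'' * U ^ 2 = (c'' * U) * U := by ring
        _ ≤ 1 * 1 := mul_le_mul hcU hU1 hU.le zero_le_one
        _ = 1 := by ring
    have h2 : (1 : ℝ) ≤ klScale klE0 m * ((4 : ℝ) ^ i₀) ^ 2 := by
      rw [show klScale klE0 m * ((4 : ℝ) ^ i₀) ^ 2 = (klScale klE0 m * (4 : ℝ) ^ i₀) * (4 : ℝ) ^ i₀ by ring]
      exact one_le_mul_of_one_le_of_one_le hlx hx₀1
    linarith
  have hρf0 : 0 ≤ (klScale klE0 m + B.smax * B.Dtmin * (3 * sectorWidth (m + 1) / 4)) / (B.Dtmin - 2 * A) +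
      π * Real.sqrt 2 * (1 + (4 + 2 * A) / (B.Dtmin - 2 * A)) * sectorWidth (m + 1) := by positivity
  have hρfb : (klScale klE0 m + B.smax * B.Dtmin * (3 * sectorWidth (m + 1) / 4)) / (B.Dtmin - 2 * A) +
      π * Real.sqrt 2 * (1 + (4 + 2 * A) / (B.Dtmin - 2 * A)) * sectorWidth (m + 1) ≤ ρfM := by
    rw [hρfM]; gcongr; exact hΛe m
  have h7ρ : 7 * (Real.sqrt 2 * ((klScale klE0 m + B.smax * B.Dtmin * (3 * sectorWidth (m + 1) / 4)) / (B.Dtmin - 2 * A) +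
      π * Real.sqrt 2 * (1 + (4 + 2 * A) / (B.Dtmin - 2 * A)) * sectorWidth (m + 1))) ≤ 7 * (Real.sqrt 2 * ρfM) := by gcongr
  have htvb : (4 + 2 * A) / (2 - 1) + 7 * (Real.sqrt 2 * ((klScale klE0 m + B.smax * B.Dtmin * (3 * sectorWidth (m + 1) / 4)) / (B.Dtmin - 2 * A) +
      π * Real.sqrt 2 * (1 + (4 + 2 * A) / (B.Dtmin - 2 * A)) * sectorWidth (m + 1))) + R.Gfr 1 * uPow 1 U / (4 : ℝ) ^ i₀ ≤ bs := by
    have h1 : R.Gfr 1 * uPow 1 U / (4 : ℝ) ^ i₀ ≤ 1 := by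
      rw [show (1 : ℕ) = 0 + 1 from rfl, euP]
      refine (div_le_self (by positivity) hx₀1).trans ?_
      calc R.Gfr 1 * U ^ 2 = (R.Gfr 1 * U) * U := by ring
        _ ≤ 1 * 1 := mul_le_mul hG1U hU1 hU.le zero_le_one
        _ = 1 := by ring
    rw [hbs, hT₀]; linarith
  have htT : (4 + 2 * A) ≤ T₀ := by rw [hT₀]; norm_num; positivity
  have htvT : (4 + 2 * A) / (2 - 1) + 7 * (Real.sqrt 2 * ((klScale klE0 m + B.smax * B.Dtmin * (3 * sectorWidth (m + 1) / 4)) / (B.Dtmin - 2 * A) +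
      π * Real.sqrt 2 * (1 + (4 + 2 * A) / (B.Dtmin - 2 * A)) * sectorWidth (m + 1))) ≤ T₀ := by rw [hT₀]; linarith
  have hs₀pos : 0 < σ * klScale klE0 (m + 1 + j) * β / M := by positivity
  have hs₀1 : σ * klScale klE0 (m + 1 + j) * β ≤ M := by
    calc σ * klScale klE0 (m + 1 + j) * β ≤ 1 * 1 * β := by gcongr
      _ = β := by ring
      _ ≤ M := hMβ
  have hP2M : (0 : ℝ) < ((2 * M : ℕ) : ℝ) := by push_cast; positivity
  have hsM' : σ * klScale klE0 (m + 1 + j) * β / M * (2 * (M : ℝ)) ≤ 2 * σ * klScale klE0 (m + 1 + j) * β := by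
    rw [show σ * klScale klE0 (m + 1 + j) * β / M * (2 * (M : ℝ)) = 2 * σ * klScale klE0 (m + 1 + j) * β by field_simp]
  have hsM : σ * klScale klE0 (m + 1 + j) * β / M * ((2 * M : ℕ) : ℝ) ≤ 2 * σ * klScale klE0 (m + 1 + j) * β := by push_cast; exact hsM'
  have hM2 : (0 : ℝ) < 2 * (M : ℝ) := by positivity
  have hΛnw : klScale klE0 nw ≤ klScale klE0 (m + 1 + j) := hanti hnw
  have hΛnw0 : 0 ≤ klScale klE0 nw := (klth_klScale_pos _).le
  obtain ⟨hDw0, hDw1, hdom₀, hdom₁, hDwb⟩ := telRegime_weights hΛs hΛnw0 hΛnw hρ0 hσ0 hx₀0 hΛx hβ0 hM0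
  have hs2 : Real.sqrt 2 ≤ 2 := by rw [show (2 : ℝ) = Real.sqrt 4 by rw [show (4:ℝ) = 2^2 by norm_num, Real.sqrt_sq (by norm_num)]]; exact Real.sqrt_le_sqrt (by norm_num)
  have hℓ25 : 2 * π / (L : ℝ) * ((2 : ℝ) + 1 / 2) ≤ 1 / 30 := by rw [← abs_of_pos (by positivity : (0 : ℝ) < 2 * π / L)]; linarith only [hLz2]
  have hLe : 7 * (2 * π / (L : ℝ)) ≤ bs := by
    have : 2 * π / (L : ℝ) ≤ 2 * π / (L : ℝ) * ((2 : ℝ) + 1 / 2) := le_mul_of_one_le_right (by positivity) (by norm_num)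
    linarith only [this, hℓ25, h7bs]
  have hLv : 7 * (2 * π / (L : ℝ) * (Real.sqrt 2 * ((2 : ℝ) + 1 / 2))) ≤ bs := by
    have : 2 * π / (L : ℝ) * (Real.sqrt 2 * ((2 : ℝ) + 1 / 2)) ≤ 2 * (2 * π / (L : ℝ) * ((2 : ℝ) + 1 / 2)) := by
      rw [show 2 * π / (L : ℝ) * (Real.sqrt 2 * ((2 : ℝ) + 1 / 2)) = Real.sqrt 2 * (2 * π / (L : ℝ) * ((2 : ℝ) + 1 / 2)) by ring]
      exact mul_le_mul_of_nonneg_right hs2 (by positivity)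
    linarith only [this, hℓ25, h7bs]
  have hR₀0 : 2 * (2 * (2 : ℝ) + 1) * ((0 : ℕ) : ℝ) < (L : ℝ) := by push_cast; linarith
  have hpack := famTel_thresholds_pack (lam := klScale klE0 m) (e₀ := klE0) (d := d₀) (Ba3 := B₃a) (Λ := klScale klE0 (m + 1 + j))
    (c := β * (L : ℝ) ^ 2) (β := β) (P2M := ((2 * M : ℕ) : ℝ)) (x₀ := (4 : ℝ) ^ i₀)
    (T₀ := T₀) (E₀ := 4) (E₁ := 32 * (R.Gfr 3 / 3)) (zc := 1) (g₀ := c'') (g₁ := R.Gfr 1) (g₂ := R.Gfr 2) (g₃ := R.Gfr 3)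
    (γ₁ := R.Gfr 1 / c'') (γ₂ := R.Gfr 2 / c'') (γ₃ := R.Gfr 3 / c'') (Q := Q) (Y := 1 / klScale klE0 m ^ 2) (W := (4 : ℝ) ^ (j + 1) * (1 / klScale klE0 m ^ 2))
    (ρ := ρ) (ρ₃ := ρ₃) (σ := σ) (s₀ := σ * klScale klE0 (m + 1 + j) * β / M) (ℭ := ℭ) (𝔴 := 𝔴)
    (A := A) (ε₂ := 4 + 4 * A) (ε₃₀ := 4 + 8 * 0) (ε₃₁ := 32 * (R.Gfr 3 * U ^ 2 / 3)) (b₂ := 7) (b₂' := 0) (b₃ := 64) (b₃' := 4 * (R.Gfr 3 / 3)) (B₁ := 32 / 3) (B₂ := 448 / 3 * Real.exp 2) (B₃ := 44900) (h𝔮₁ := rfl) (h𝔮₂ := rfl) (h𝔮₃₀ := rfl)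
    (h𝔮₃₁ := rfl) (hd₁ := rfl) (hw₁ := rfl) (hd₂ := rfl) (hw₂ := rfl) (hd₃₀ := rfl) (hd₃₁ := rfl) (hw₃₀ := rfl) (hw₃₁ := rfl) (ho₁₀ := rfl) (ho₁₁ := rfl) (ho₂₀ := rfl) (ho₂₁ := rfl) (ho₂₂ := rfl) (ho₃₀ := rfl) (ho₃₁ := rfl) (ho₃₂ := rfl)
    (ho₃₃ := rfl) (hR₁₀ := rfl) (hR₁₁ := rfl) (hR₂₀ := rfl) (hR₂₁ := rfl) (hR₂₂ := rfl) (hR₃₀ := rfl) (hR₃₁ := rfl) (hR₃₂ := rfl) (hR₃₃ := rfl) (hr₁₀ := rfl) (hr₁₁ := rfl) (hr₂₀ := rfl) (hr₂₁ := rfl) (hr₂₂ := rfl) (hr₃₀ := rfl) (hr₃₁ := rfl)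
    (hr₃₂ := rfl) (hr₃₃ := rfl) (h𝔳₁ := rfl) (h𝔳₂ := rfl) (h𝔳₃₀ := rfl) (h𝔳₃₁ := rfl) (hdv₁ := rfl) (hwv₁ := rfl) (hdv₂ := rfl) (hwv₂ := rfl) (hdv₃₀ := rfl) (hdv₃₁ := rfl) (hwv₃₀ := rfl) (hwv₃₁ := rfl) (hov₁₀ := rfl) (hov₁₁ := rfl) (hov₂₀ := rfl)
    (hov₂₁ := rfl) (hov₂₂ := rfl) (hov₃₀ := rfl) (hov₃₁ := rfl) (hov₃₂ := rfl) (hov₃₃ := rfl) (hRv₁₀ := rfl) (hRv₁₁ := rfl) (hRv₂₀ := rfl) (hRv₂₁ := rfl) (hRv₂₂ := rfl) (hRv₃₀ := rfl) (hRv₃₁ := rfl) (hRv₃₂ := rfl) (hRv₃₃ := rfl) (hrv₁₀ := rfl)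
    (hrv₁₁ := rfl) (hrv₂₀ := rfl) (hrv₂₁ := rfl) (hrv₂₂ := rfl) (hrv₃₀ := rfl) (hrv₃₁ := rfl) (hrv₃₂ := rfl) (hrv₃₃ := rfl) (hqt₁ := rfl) (hqt₂ := rfl) (hqt₃ := rfl) (hDt₁ := rfl) (hDt₂ := rfl) (hθ₁ := rfl) (hθ₂ := rfl) (hθ₃ := rfl) (hk₁ := rfl)
    (hk₂ := rfl) (hk₃ := rfl) (hC₀ := rfl) (hC₁' := rfl) (hC₂ := rfl) (hC₃ := rfl) (hCv₀ := rfl) (hCv₁ := rfl) (hCv₂ := rfl) (hCv₃ := rfl) (hCw₀ := rfl) (hCw₁ := rfl) (hCw₂ := rfl) (hKc := rfl) (hKw := rfl) (hlam := hlam0) (hlam1 := hlam1)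
    (hY1 := hY1) (hY := hY) (hY2 := le_rfl) (ht0 := (by positivity)) (htT := htT) (htv0 := (by positivity)) (htvT := htvT) (hG₀ := hG₀pos) (hG₀g := hG₀g) (hG₁γ := hG₁γ) (hG₂γ := hG₂γ) (hG₃γ := hG₃γ) (hG₁g := hG₁g) (hG₂g := hG₂g) (hG₃g := hG₃g)
    (hζ0 := (by positivity)) (hζY := hζ) (hε₃₀0 := (by norm_num)) (hε₃₀E := (by norm_num)) (hε₃₁0 := (by positivity)) (hε₃₁E := hE₁) (hκe := rfl) (hQ := hQ) (hΛ := hΛs) (hΛlam := hΛlam) (hc := (by positivity)) (hβ := hβ0) (hYW := hYW) (hΛW := hΛW)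
    (hQ0 := hQ0) (hρ := hρ0) (hρ₃ := hρ₃0) (hx₀ := hx₀W) (hbs := hbs0) (hb₂ := (by norm_num)) (hb₂' := le_rfl) (hb₃ := (by norm_num)) (hb₃' := (by positivity)) (hB₁ := (by norm_num)) (hB₂ := (by positivity)) (hB₃ := (by norm_num)) (hℭ := hℭ)
    (h𝔴 := h𝔴) (hρℭ := hρℭ) (hρ𝔴 := hρ𝔴) (hd := hd₀) (hs₀ := hs₀pos) (hP2M := hP2M) (hσ := hσ0) (hsM := hsM) (hΘ := (by rw [← hΘt]; exact hΘ))
  obtain ⟨hrows, hcols⟩ := rowSumWt_sliceCT_famBand_tel_le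
    (B := B) (Kf := Kf) (i₀ := i₀) (dn := dn) (hA := hAK) (hA3 := (fun i h1 h2 p => by rw [zero_add]; exact h3s i h1 h2 p)) (hA₃₀ := le_rfl) (hA₃₁ := hA31) (hADt := hADt) (he := he) (hz := (by norm_num : (0 : ℝ) < 1 / 10))
    (hz1 := (by norm_num : (1 / 10 : ℝ) ≤ 1)) (hgap := hgap) (h3 := h3) (hlo := hlo) (hhi := hhi) (hβ := hβ0) (hρA := hρA) (m := m) (hMm := hMm) (hd := hd₀) (hd1 := hd₀1) (hd2 := hd₀2) (hd3 := hd₀3) (hd4 := hd₀4) (hB0 := hB₀0) (hB := hB₀)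
    (hB30 := hB₃a0) (hB3 := hB₃a) (hNr := (le_refl (2 : ℝ))) (hLz := hLz2) (hR₀ := hR₀0) (hx₀ := rfl) (hG₀pos := hG₀pos) (hR := hR) (hc'' := hc''.le) (hJ := hJ) (hO := hO) (hinc := hinc) (hG₀ := rfl) (hGi₁ := rfl) (hGi₂ := rfl) (hGi₃ := rfl)
    (hε₃₀ := rfl) (hε₃₁ := rfl) (ha₃s := le_rfl) (hGΛ := hGΛ) (hΛ := hΛs) (hΛΛ' := hΛΛ') (hM' := hM') (hKb₁ := hK₁) (hKb₂ := hK₂) (hKb₃ := h3l) (hKb₃₀ := (by norm_num : (0 : ℝ) ≤ 64)) (hKb₃₁ := hA31) (hK₃s := hK3s) (hbs := hbs0) (hKb₁b := h7bs)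
    (hb₂ := le_rfl) (hb₂' := le_rfl) (hb₃ := le_rfl) (hb₃' := hb3') (hB₁ := hB₁) (hB₂ := hB₂) (hB₃ := hB₃) (hB₄ := hB₄) (hρf := rfl) (hκ := rfl) (hC₁ := rfl) (hε₂ := rfl) (hζ := rfl) (ht := rfl) (h𝔮₁ := rfl) (h𝔮₂ := rfl) (h𝔮₃₀ := rfl)
    (h𝔮₃₁ := rfl) (hd₁ := rfl) (hw₁ := rfl) (hd₂ := rfl) (hw₂ := rfl) (hd₃₀ := rfl) (hd₃₁ := rfl) (hw₃₀ := rfl) (hw₃₁ := rfl) (ho₁₀ := rfl) (ho₁₁ := rfl) (ho₂₀ := rfl) (ho₂₁ := rfl) (ho₂₂ := rfl) (ho₃₀ := rfl) (ho₃₁ := rfl) (ho₃₂ := rfl)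
    (ho₃₃ := rfl) (hR₁₀ := rfl) (hR₁₁ := rfl) (hR₂₀ := rfl) (hR₂₁ := rfl) (hR₂₂ := rfl) (hR₃₀ := rfl) (hR₃₁ := rfl) (hR₃₂ := rfl) (hR₃₃ := rfl) (hr₁₀ := rfl) (hr₁₁ := rfl) (hr₂₀ := rfl) (hr₂₁ := rfl) (hr₂₂ := rfl) (hr₃₀ := rfl) (hr₃₁ := rfl)
    (hr₃₂ := rfl) (hr₃₃ := rfl) (htv := rfl) (h𝔳₁ := rfl) (h𝔳₂ := rfl) (h𝔳₃₀ := rfl) (h𝔳₃₁ := rfl) (hdv₁ := rfl) (hwv₁ := rfl) (hdv₂ := rfl) (hwv₂ := rfl) (hdv₃₀ := rfl) (hdv₃₁ := rfl) (hwv₃₀ := rfl) (hwv₃₁ := rfl) (hov₁₀ := rfl) (hov₁₁ := rfl)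
    (hov₂₀ := rfl) (hov₂₁ := rfl) (hov₂₂ := rfl) (hov₃₀ := rfl) (hov₃₁ := rfl) (hov₃₂ := rfl) (hov₃₃ := rfl) (hRv₁₀ := rfl) (hRv₁₁ := rfl) (hRv₂₀ := rfl) (hRv₂₁ := rfl) (hRv₂₂ := rfl) (hRv₃₀ := rfl) (hRv₃₁ := rfl) (hRv₃₂ := rfl) (hRv₃₃ := rfl)
    (hrv₁₀ := rfl) (hrv₁₁ := rfl) (hrv₂₀ := rfl) (hrv₂₁ := rfl) (hrv₂₂ := rfl) (hrv₃₀ := rfl) (hrv₃₁ := rfl) (hrv₃₂ := rfl) (hrv₃₃ := rfl) (hqt₁ := rfl) (hqt₂ := rfl) (hqt₃ := rfl) (hDt₁ := rfl) (hDt₂ := rfl) (hθ₁ := rfl) (hθ₂ := rfl) (hθ₃ := rfl)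
    (htvb := htvb) (hℓ₁ := rfl) (hℓ := rfl) (hGp₁ := rfl) (hGp₂ := rfl) (hGp₃ := rfl) (hwsi := rfl) (hτt := rfl) (hAe1 := rfl) (hAe2 := rfl) (hAn1 := rfl) (hAn2 := rfl) (hAv1 := rfl) (hAv2 := rfl) (hX₀s := rfl) (hX₁s := rfl) (hX₂s := rfl)
    (hX₃s := rfl) (hTts := rfl) (hs₀ := hs₀pos) (hρ := hρ0) (hρ₃ := hρ₃0) (hκA := rfl) (hκB := rfl) (hAΔs := rfl) (hLe := hLe) (hLv := hLv) (hk₁ := rfl) (hk₂ := rfl) (hk₃ := rfl) (htime := hpack.2) (hC₀ := rfl) (hC₁' := rfl) (hC₂ := rfl)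
    (hC₃ := rfl) (hCv₀ := rfl) (hCv₁ := rfl) (hCv₂ := rfl) (hCv₃ := rfl) (hCw₀ := rfl) (hCw₁ := rfl) (hCw₂ := rfl) (hKc := rfl) (hKw := rfl) (th₃ := hpack.1.1.1) (th₂ := hpack.1.1.2.1) (th₁ := hpack.1.1.2.2.1) (th₀ := hpack.1.1.2.2.2)
    (tv₃ := hpack.1.2.1.1) (tv₂ := hpack.1.2.1.2.1) (tv₁ := hpack.1.2.1.2.2.1) (tv₀ := hpack.1.2.1.2.2.2) (tw₂ := hpack.1.2.2.1) (tw₁ := hpack.1.2.2.2.1) (tw₀ := hpack.1.2.2.2.2) (nw := nw) (hDw := hDw1) (hdom₀ := hdom₀) (hdom₁ := hdom₁)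
    (hΦ := rfl) (hΨ := rfl) (R₀ := 0)
  have hamp := covTel_amp_pack (lam := klScale klE0 m) (Λ := klScale klE0 (m + 1 + j)) (c := β * (L : ℝ) ^ 2) (β := β) (P2M := 2 * (M : ℝ)) (Lr := (L : ℝ)) (x₀ := (4 : ℝ) ^ i₀)
    (ε₂ := 4 + 4 * A) (Kb₁ := 7) (Kb₂ := 7) (K₃s := 64 + R.Gfr 3 / 3) (B₁ := 32 / 3) (B₂ := 448 / 3 * Real.exp 2) (B₃ := 44900) (B₄ := 3960000) (ρ := ρ) (ρ₃ := ρ₃) (s₀ := σ * klScale klE0 (m + 1 + j) * β / M) (hℓ₁ := rfl) (hℓ := rfl) (hGp₁ := rfl)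
    (hGp₂ := rfl) (hGp₃ := rfl) (hAe1 := rfl) (hAe2 := rfl) (hAn1 := rfl) (hAn2 := rfl) (hAv1 := rfl) (hAv2 := rfl) (hX₀s := rfl) (hX₁s := rfl) (hX₂s := rfl) (hX₃s := rfl) (hTts := rfl) (hκA := rfl) (hκB := rfl) (hAΔs := rfl) (hs₀ := hs₀pos)
    (hρ := hρ0) (hΛ := hΛs) (hΛlam := hΛlam) (hlam1 := hlam1) (hc := (by positivity)) (hβ := hβ0) (hLr := hL1r) (hx₀ := hx₀1) (hΛx := hΛx) (hlx := hlx) (hA := hA0.le) (hd := hd₀) (hBa := hB₀0) (hBa3 := hB₃a0) (hε₂ := (by positivity)) (he := he.le)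
    (hG₀ := hG₀pos.le) (hG₀g := hG₀g) (hGi₁ := hG₁γ) (hGi₂ := hG₂γ) (hGi₃ := hG₃γ) (hγ₁ := (by positivity)) (hγ₂ := (by positivity)) (hγ₃ := (by positivity)) (hKb₁ := (by norm_num)) (hKb₂ := (by norm_num)) (hK₃s := (by positivity))
    (hB₁ := (by norm_num)) (hB₂ := (by positivity)) (hB₃ := (by norm_num)) (hB₄ := (by norm_num)) (hρf0 := hρf0) (hρfM := hρfb) (hwsi0 := (by have := sectorWidth_pos (m + 1); positivity)) (hw := hwsi) (ha₃s := ha₃s) (h𝔞₃ := (by positivity))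
    (hP2M := hM2) (hsM := hsM')
  have hincr := famTel_increment_scalar_le' (j := j) (m := m) B hA0.le hγ hDtA he hd₀ hΛs hΛs1 hΛ₁ hlamΛ hβ0 hL0 hM0 hN2 hπβ hNΛ hw rfl hcρ rfl rfl hLN hL1 hσ0 rfl hs₀1 hρ0 hρ₃0
    hx₀1 hDw0 hDc0.le (by rw [hDc]; exact hDwb) hG₀pos.le hc''.le (le_of_eq euP0) (by positivity) hamp
  rw [← h𝒜c, ← h𝒦] at hincr
  have hcast : ((2 * M : ℕ) : ℝ) = 2 * (M : ℝ) := by push_cast; ring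
  rw [hcast] at hrows hcols
  have hdn : (0 : ℝ) ≤ dn := Nat.cast_nonneg _
  have key := mul_le_mul_of_nonneg_left hincr hdn
  simp only [hslice]
  exact ⟨fun Y => (hrows Y).trans (add_le_add le_rfl key), fun Y' => (hcols Y').trans (add_le_add le_rfl key)⟩

end Summit.HubbardSuperconductivity.HubbardSuperconductivity.Theorems.TorusFourierL2

end
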